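import Summits.AtomisticToContinuum.HydrodynamicLimit.Theorems.JParityClosureParityInBandBridge
import Summits.AtomisticToContinuum.HydrodynamicLimit.Theorems.JParityClosureParityInBandEos
import Summits.AtomisticToContinuum.HydrodynamicLimit.Theorems.InformationPercolationEngineChaosClosesEulerReductionEuler
import Literature.Analysis.FluidPDE.MVWeakStrongUniquenessProofs
import Literature.Analysis.FunctionSpaces.TorusMollifierEstimates
import HarnessLib

/-!
# BF18 shell for functions (crux `ChaosClosesEuler`, stmt-AtomisticToContinuum-15141, line `Sketch`,
# stub `stub_bf18Shell`) — assembly part 1: the classical data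

WHAT. The deterministic BF18 shell compares a genuine field with a classical hard-sphere Euler solution
`(ρ, u, θ)` on `[0, T)` lying in the band `ρσ³ ≤ η₁/2`, through the equation of state
`eos = EulerEOS.monatomicExcess χe f` (a `C²` band extension of the hard-sphere law). This file collects what
the assembly needs from the CLASSICAL side, in the vocabulary of the tree's relative-energy machinery
(`pdAt`, `StrongPointData`, `TestTriple`, `contI`, `pt`, `divPU`):

* `classical` — the solution is an `IsClassicalEulerSolution eos T ρ u θ` (pressure agreement in the band);
* `exists_bounds` — on `[0, t'] × 𝕋³`, `t' < T`: a bound `M` of the point data, a coefficient bound `N`,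
  and the compact range `K ⊆ (0,∞)²` of `(ρ, θ)` (`‖u‖ ≤ 3|M|` is `ChaosClosesEulerShellInit.norm_U_le_of_bounded`);
* `pointEqs` — the pointwise continuity / temperature / momentum equations of the data;
* `cont_identity` — the shell's continuity hypothesis (H1), valid for `C¹` space–time tests, applied to the
  global `C¹` extension `ψ₁` of BF's test function `½|u|² − μ(ρ,θ)` and rewritten as `∫∫ contI`;
* `pressure_identity` — `∫ p̃(τ) − ∫ p̃(0) = ∫₀^τ ∫ ∂ₜp̃` in iterated form;
* `divPU_integral_zero` — `∫₀^τ ∫ (p̃ div ũ + ũ·∇p̃) = 0` in iterated form.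

WHY. These are the `V`-independent inputs of the weighted relative-energy inequality
`∫ w F ≤ F(0) + 2δ + ∫ cut · ∫ rawRHS` of the shell (assembly part 2).

No named fact is invoked.
-/

noncomputable section

namespace Summit.AtomisticToContinuum.HydrodynamicLimit.Theorems.ChaosClosesEulerShellData

open Set MeasureTheory Function
open scoped BigOperators InnerProductSpace
open Literature.MathematicalPhysics.KineticTheory
open Literature.Analysis.FluidPDE Literature.Analysis.FluidPDE.CompressibleEuler
open Literature.Analysis.FluidPDE.CompressibleEuler.StrongPointData
open Literature.Analysis.FluidPDE.CompressibleEuler.EulerPhase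
open Literature.Analysis.FunctionSpaces

variable {χe f : ℝ → ℝ} {σ η₁ T : ℝ} {ρ θ : ℝ → T3 → ℝ} {u : ℝ → T3 → V3}

/-! ## §1 The classical hard-sphere solution in the band is a classical `eos`-solution -/

/-- **The band bridge.** A classical hard-sphere Euler solution with `ρσ³ ≤ η₁/2` is a classical solution for
`eos = monatomicExcess χe f` whenever `χe = hsCompressibility(·σ³)` on the band `ρσ³ ≤ η₁`. [folklore] -/
theorem classical (h : IsHardSphereEulerSolution σ T ρ u θ)
    (hband : ∀ s ∈ Ico 0 T, ∀ x, ρ s x * σ ^ 3 ≤ η₁ / 2) (hη₁ : 0 < η₁)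
    (hcomp : ∀ a, 0 < a → a * σ ^ 3 ≤ η₁ → χe a = hsCompressibility (a * σ ^ 3)) :
    IsClassicalEulerSolution (EulerEOS.monatomicExcess χe f) T ρ u θ := by
  refine isClassicalEulerSolution_of_isHardSphereEulerSolution_of_eqOn h
    (S := {q : ℝ × ℝ | 0 < q.1 ∧ q.1 * σ ^ 3 ≤ η₁}) (fun t ht x => ⟨h.density_pos t ht x, ?_⟩) ?_ ?_
  · exact (hband t ht x).trans (by linarith)
  · rintro ⟨r, Θ⟩ ⟨hr, hrb⟩
    simp only [EulerEOS.monatomicExcess, hsPressure, hcomp r hr hrb]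
  · rintro ⟨r, Θ⟩ _
    simp [EulerEOS.monatomicExcess]

/-! ## §2 Bounds of the data on `[0, t'] × 𝕋³` -/

/-- **Bounds of the classical data on `[0, t'] × 𝕋³` (`t' < T`).** A bound `M ≥ 0` of the point data, a
coefficient bound `N ≥ 0`, and the compact range `K ⊆ (0,∞)²` of `(ρ, θ)`. [folklore] -/
theorem exists_bounds {eos : EulerEOS} (hcl : IsClassicalEulerSolution eos T ρ u θ) (hG : eos.IsGibbs)
    {t' : ℝ} (ht'0 : 0 ≤ t') (ht' : t' < T) :
    ∃ M N : ℝ, 0 ≤ M ∧ 0 ≤ N ∧ (∀ s ∈ Icc 0 t', ∀ x, (pdAt T ρ u θ (s, x)).Bounded M) ∧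
      CoeffBound eos T ρ u θ t' N ∧
      IsCompact ((fun z : ℝ × T3 => (ρ z.1 z.2, θ z.1 z.2)) '' (Icc 0 t' ×ˢ univ)) ∧
      (fun z : ℝ × T3 => (ρ z.1 z.2, θ z.1 z.2)) '' (Icc 0 t' ×ˢ univ) ⊆ Ioi 0 ×ˢ Ioi 0 ∧
      (∀ s ∈ Icc 0 t', ∀ x, ((pdAt T ρ u θ (s, x)).r, (pdAt T ρ u θ (s, x)).Θ) ∈
        (fun z : ℝ × T3 => (ρ z.1 z.2, θ z.1 z.2)) '' (Icc 0 t' ×ˢ univ)) := by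
  obtain ⟨M, hM0, hM⟩ := hcl.exists_bound_pointData ht'
  obtain ⟨N, hN⟩ := hcl.exists_coeffBound hG ht'0 ht' hM0 hM
  obtain ⟨hK, hKq⟩ := hcl.isCompact_range_thermo ht'
  have hN0 : 0 ≤ N := (abs_nonneg _).trans (hN 0 ⟨le_rfl, ht'0⟩ 0).2.1
  exact ⟨M, N, hM0, hN0, hM, hN, hK, hKq, fun s hs x => ⟨(s, x), ⟨hs, mem_univ _⟩, rfl⟩⟩

/-- **The pointwise equations of the data** (continuity, temperature, momentum) on `[0, T)`. [folklore] -/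
theorem pointEqs {eos : EulerEOS} (hcl : IsClassicalEulerSolution eos T ρ u θ) (hG : eos.IsGibbs)
    {s : ℝ} (hs : s ∈ Ico 0 T) (x : T3) :
    (pdAt T ρ u θ (s, x)).MassEq ∧ (pdAt T ρ u θ (s, x)).TemperatureEq eos ∧
      (pdAt T ρ u θ (s, x)).MomentumEq eos :=
  ⟨hcl.massEq_pointData hs x, hcl.temperatureEq_pointData hG hs x, hcl.momentumEq_pointData hG hs x⟩

/-! ## §3 The continuity hypothesis tested with `ψ₁` -/

/-- **(H1) with BF's test function.** If the continuity identity holds for every `C¹` space–time test, then —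
tested with the global `C¹` extension `ψ₁` of `½|u|² − μ(ρ,θ)` — it reads
`∫ ψ₁(τ) ϱ(τ) − ∫ ψ₁(0) ϱ(0) = ∫₀^τ ∫ contI` for `τ ≤ t ≤ T'`. [cite: BrezinaFeireisl2018, (3.4)] -/
theorem cont_identity {eos : EulerEOS} (hcl : IsClassicalEulerSolution eos T ρ u θ) (hG : eos.IsGibbs)
    {t₁ : ℝ} (Ψ : TestTriple eos t₁ T ρ u θ) {V : ℝ → T3 → ℝ × V3 × ℝ} {t : ℝ} (ht : t ≤ t₁)
    (H1 : ∀ φ : ℝ → T3 → ℝ, ContDiff ℝ 1 (Torus.stLift φ) → ∀ τ ∈ Icc 0 t,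
      (∫ x, φ τ x * (V τ x).1) - ∫ x, φ 0 x * (V 0 x).1 =
        ∫ s in Icc 0 τ, ∫ x, (deriv (fun s' => φ s' x) s * (V s x).1 +
          ∑ k : Fin 3, (V s x).2.1 k * Torus.partialDeriv k (φ s) x))
    {τ : ℝ} (hτ : τ ∈ Icc 0 t) :
    (∫ x, Ψ.ψ₁ τ x * (V τ x).1) - ∫ x, Ψ.ψ₁ 0 x * (V 0 x).1 =
      ∫ s in Icc 0 τ, ∫ x, (pdAt T ρ u θ (s, x)).contI eos
        ((V s x).1, (V s x).2.2 - ‖(V s x).2.1‖ ^ 2 / (2 * (V s x).1), (V s x).2.1) := by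
  rw [H1 Ψ.ψ₁ Ψ.hψ₁ τ hτ, integral_Icc_eq_integral_Ioo, integral_Icc_eq_integral_Ioo]
  refine setIntegral_congr_fun measurableSet_Ioo fun s hs => ?_
  have hs' : s ∈ Ioo 0 Ψ.T' := ⟨hs.1, lt_of_lt_of_le hs.2 (hτ.2.trans (ht.trans Ψ.hT.le))⟩
  have hsT : s ∈ Ico 0 T := ⟨hs.1.le, hs'.2.trans Ψ.hT'⟩
  refine integral_congr_ae (ae_of_all _ fun x => ?_)
  have h1 : deriv (fun s' => Ψ.ψ₁ s' x) s = (pdAt T ρ u θ (s, x)).φ₁t eos :=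
    Ψ.timeDeriv_ψ₁ hcl hG hs' x
  have hψs : Torus.IsContDiff 1 (Ψ.ψ₁ s) := by
    have : Ψ.ψ₁ s = energyTestFunction eos ρ u θ s := funext (Ψ.eq₁ s ⟨hs'.1.le, hs'.2.le⟩)
    rw [this]; exact hcl.isContDiff_energyTestFunction hG hsT
  have h2 : ∀ k, Torus.partialDeriv k (Ψ.ψ₁ s) x = (pdAt T ρ u θ (s, x)).gφ₁ eos k := fun k => by
    rw [← Torus.gradient_apply hψs, Ψ.gradient_ψ₁ hcl hG ⟨hs'.1.le, hs'.2.le⟩ hsT x k]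
  simp only [h1, h2, StrongPointData.contI, dens_mk, mom_mk]
  ring

/-! ## §4 The pressure of the data -/

/-- **`∫ p̃(τ) − ∫ p̃(0) = ∫₀^τ ∫ ∂ₜp̃`**, iterated form, for `τ ∈ [0, t']`, `t' < T` (`N` a bound of
`∂ₜp̃` on `[0,t'] × 𝕋³`). [cite: BrezinaFeireisl2018, §3.2.2] -/
theorem pressure_identity {eos : EulerEOS} (hcl : IsClassicalEulerSolution eos T ρ u θ) (hG : eos.IsGibbs)
    {t' N : ℝ} (ht' : t' < T) (hN : CoeffBound eos T ρ u θ t' N) {τ : ℝ} (hτ : τ ∈ Icc 0 t') :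
    (∫ x, eos.p (ρ τ x) (θ τ x)) - ∫ x, eos.p (ρ 0 x) (θ 0 x) =
      ∫ s in Icc 0 τ, ∫ x, (pdAt T ρ u θ (s, x)).pt eos := by
  rcases hτ.1.eq_or_lt with h0 | hτ0
  · subst h0; simp
  have hτT : τ ∈ Ioo 0 T := ⟨hτ0, lt_of_le_of_lt hτ.2 ht'⟩
  have hNτ : ∀ s ∈ Icc 0 τ, ∀ x, |(pdAt T ρ u θ (s, x)).pt eos| ≤ N := fun s hs x =>
    (hN s ⟨hs.1, hs.2.trans hτ.2⟩ x).2.2.2.1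
  rw [pressure_ftc hcl hG hτT hNτ]
  -- Fubini on the strip `(0,τ) × 𝕋³`: the integrand is continuous and bounded
  obtain ⟨-, -, cpt, -⟩ := hcl.continuousOn_coeffs hG
  have hmeasS : MeasurableSet (Ioo (0 : ℝ) τ ×ˢ (univ : Set T3)) := measurableSet_Ioo.prod MeasurableSet.univ
  have hcont : ContinuousOn (fun z => (pdAt T ρ u θ z).pt eos) (Ioo 0 τ ×ˢ univ) :=
    cpt.mono (prod_mono (Ioo_subset_Ioo_right hτT.2.le) subset_rfl)
  haveI : IsFiniteMeasure ((volume : Measure (ℝ × T3)).restrict (Ioo 0 τ ×ˢ univ)) := by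
    refine ⟨?_⟩
    rw [Measure.restrict_apply_univ, Measure.volume_eq_prod, Measure.prod_prod]
    exact ENNReal.mul_lt_top measure_Ioo_lt_top (measure_lt_top _ _)
  have hint : IntegrableOn (fun z => (pdAt T ρ u θ z).pt eos) (Ioo 0 τ ×ˢ univ) volume := by
    refine ⟨hcont.aestronglyMeasurable hmeasS, ?_⟩
    refine HasFiniteIntegral.of_bounded (C := N) ?_
    rw [ae_restrict_iff' hmeasS]
    exact ae_of_all _ fun z hz => by
      rw [Real.norm_eq_abs]; exact hNτ z.1 ⟨hz.1.1.le, hz.1.2.le⟩ z.2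
  rw [Measure.volume_eq_prod] at hint ⊢
  rw [setIntegral_prod _ hint, integral_Icc_eq_integral_Ioo]
  simp only [Measure.restrict_univ]

/-! ## §5 The divergence term integrates to zero -/

/-- **`∫₀^τ ∫ (p̃ div ũ + ũ·∇p̃) = 0`**, iterated form, for `τ ∈ (0, t')`, `t' < T`. [cite: BrezinaFeireisl2018, §3.2.2] -/
theorem divPU_integral_zero {eos : EulerEOS} (hcl : IsClassicalEulerSolution eos T ρ u θ) (hG : eos.IsGibbs)
    {t' M N : ℝ} (ht' : t' < T) (hM : ∀ s ∈ Icc 0 t', ∀ x, (pdAt T ρ u θ (s, x)).Bounded M)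
    (hN : CoeffBound eos T ρ u θ t' N) {τ : ℝ} (hτ : τ ∈ Ioo 0 t') :
    ∫ s in Icc 0 τ, ∫ x, divPU eos (pdAt T ρ u θ (s, x)) = 0 := by
  obtain ⟨hint, hzero⟩ := setIntegral_divPU_eq_zero hcl hG ht' hM hN hτ
  rw [Measure.volume_eq_prod] at hint hzero
  rw [setIntegral_prod _ hint] at hzero
  rw [integral_Icc_eq_integral_Ioo]
  simpa only [Measure.restrict_univ] using hzero

/-! ## §6 The band-extension equation of state satisfies every hypothesis of the shell's helpers -/

/-- **EOS package** for `monatomicExcess χe f`: Gibbs, stability, temperature inversion, `e > 0`, and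
continuity of `χe, f` on `(0,∞)`. [folklore] -/
theorem eos_package (hχ : ContDiffOn ℝ 2 χe (Ioi 0)) (hf : ContDiffOn ℝ 2 f (Ioi 0))
    (hvir : ∀ a, 0 < a → χe a = 1 + a * deriv f a) (hmono : ∀ a, 0 < a → 0 < χe a + a * deriv χe a)
    {B : ℝ} (hB : ∀ a, 0 < a → |χe a| ≤ B) :
    (EulerEOS.monatomicExcess χe f).IsGibbs ∧ (EulerEOS.monatomicExcess χe f).IsThermodynamicallyStable ∧
    (∀ r E : ℝ, 0 < r → 0 < E → 0 < (EulerEOS.monatomicExcess χe f).temperature r E ∧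
      r * (EulerEOS.monatomicExcess χe f).e r ((EulerEOS.monatomicExcess χe f).temperature r E) = E) ∧
    (∀ r Θ : ℝ, 0 < r → 0 < Θ → 0 < (EulerEOS.monatomicExcess χe f).e r Θ) ∧
    ContinuousOn χe (Ioi 0) ∧ ContinuousOn f (Ioi 0) := by
  obtain ⟨hG, hS, -, -, -, he, htemp, -⟩ := monatomicExcess_bf_hypotheses χe f hχ hf hvir hmono hB
  exact ⟨hG, hS, htemp, he, hχ.continuousOn, hf.continuousOn⟩

/-- REGISTERED SUB-GOAL `stub_bf18ShellData` of the line `Sketch` (assembly part 1 of `stub_bf18Shell`): the band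
bridge `classical`. [folklore] -/
theorem stub_bf18ShellData : ∀ (χe f : ℝ → ℝ) (σ η₁ T : ℝ) (ρ θ : ℝ → T3 → ℝ) (u : ℝ → T3 → V3),
    IsHardSphereEulerSolution σ T ρ u θ → (∀ s ∈ Set.Ico 0 T, ∀ x, ρ s x * σ ^ 3 ≤ η₁ / 2) → 0 < η₁ →
    (∀ a, 0 < a → a * σ ^ 3 ≤ η₁ → χe a = hsCompressibility (a * σ ^ 3)) →
    IsClassicalEulerSolution (EulerEOS.monatomicExcess χe f) T ρ u θ :=
  fun _χe _f _σ _η₁ _T _ρ _θ _u h hband hη₁ hcomp => classical h hband hη₁ hcomp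

end Summit.AtomisticToContinuum.HydrodynamicLimit.Theorems.ChaosClosesEulerShellData

end
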